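import Mathlib
import Summits.ResolutionOfSingularities.ResolutionOfSingularities.Theorems.WeightedInvariantLocalWeightedDropMonicDescentLabels
import Summits.ResolutionOfSingularities.ResolutionOfSingularities.Theorems.WeightedInvariantLocalWeightedDropMonicDescentBlowOneLaws

/-!
# `WeightedInvariant.LocalWeightedDrop`, sub-stub N4″: the scaled polygon invariants — attainment and the transformation laws (piece T-3a′)

Crux item stmt-ResolutionOfSingularities-8899 `LocalWeightedDrop` (route `ResolutionOfSingularities/WeightedInvariant`), door
`WeightedConstruction` stmt-ResolutionOfSingularities-0571.  [OURS · L1 W4.3, chain w43, lead prover; piece T-3a′ of `N4PRIME-PLAN.md` (tools for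
T-5′ `stub_monicDescentNoChain`).  MODEL: Cossart–Jannsen–Saito LNM 2270 Def. 11.1 and the inequalities (11.1), Lemma 12.1 (3) / 13.2 (2)
(`α′ = δ − 1`, `β′ = γ⁻ ≤ β`; `ε′ = ε`, `ζ′ = ζ + ε − 1`), Lemma 12.2 / 13.4 (2) (`α′ = α`, `β′ = α + β − 1`), Lemma 12.4 (curve blow-up: shift);
here for the SCALED invariants `deltaL, alphaL, betaL, gammaL, epsL, zetaL` of a point set `N ⊂ ℕ²` (`…MonicDescentLabels`), pure combinatorics.]

* attainment / minimality: `alphaL_le`, `exists_eq_alphaL`, … for all six invariants; `deltaL_le_alphaL_add_betaL`, `gammaL_le_betaL`;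
* `u₁`-chart point blow-up (`N′ = psi 2 '' N`, all points with `P₀ + P₁ ≥ 2`): `alphaL_image_psi` (`= δ − 2`), `betaL_image_psi` (`= γ⁻`),
  `epsL_image_psi` (`= ε`), `zetaL_image_psi` (`= ζ + ε − 2`), hence `betaL_image_psi_le` (`β′ ≤ β`);
* `u₂`-chart point blow-up (`N′ = phi '' N`, `phi P = (P₀, P₀ + P₁ − 2)`): `alphaL_image_phi` (`= α`), `betaL_image_phi` (`= α + β − 2`);
* curve blow-ups (shifts `P ↦ P − (2,0)` resp. `P − (0,2)`): `alphaL_image_shiftOne` (`α − 2`), `betaL_image_shiftOne` (`β`), `betaL_image_shiftTwo`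
  (`β − 2`), `epsL_image_shiftOne`, `zetaL_image_shiftOne` (`ζ − 2`).
-/

set_option linter.dupNamespace false -- mandated namespace of this single-conjunct summit

noncomputable section

namespace Summit.ResolutionOfSingularities.ResolutionOfSingularities.Theorems

namespace MonicDescent

variable (N : Set (Fin 2 →₀ ℕ))

/-! ## Attainment and minimality -/

/-- `2α ≤ P₀`. -/
theorem alphaL_le {N : Set (Fin 2 →₀ ℕ)} {P : Fin 2 →₀ ℕ} (hP : P ∈ N) : alphaL N ≤ P 0 :=
  Nat.sInf_le ⟨P, hP, rfl⟩

/-- `2α` is attained. -/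
theorem exists_eq_alphaL {N : Set (Fin 2 →₀ ℕ)} (hN : N.Nonempty) : ∃ P ∈ N, P 0 = alphaL N := by
  have h := Nat.sInf_mem (hN.image (fun P : Fin 2 →₀ ℕ => P 0))
  obtain ⟨P, hP, hPeq⟩ := h
  exact ⟨P, hP, hPeq⟩

/-- `2δ ≤ P₀ + P₁`. -/
theorem deltaL_le {N : Set (Fin 2 →₀ ℕ)} {P : Fin 2 →₀ ℕ} (hP : P ∈ N) : deltaL N ≤ P 0 + P 1 :=
  Nat.sInf_le ⟨P, hP, rfl⟩

/-- `2δ` is attained. -/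
theorem exists_eq_deltaL {N : Set (Fin 2 →₀ ℕ)} (hN : N.Nonempty) : ∃ P ∈ N, P 0 + P 1 = deltaL N := by
  obtain ⟨P, hP, hPeq⟩ := Nat.sInf_mem (hN.image (fun P : Fin 2 →₀ ℕ => P 0 + P 1))
  exact ⟨P, hP, hPeq⟩

/-- `2ε ≤ P₁`. -/
theorem epsL_le {N : Set (Fin 2 →₀ ℕ)} {P : Fin 2 →₀ ℕ} (hP : P ∈ N) : epsL N ≤ P 1 :=
  Nat.sInf_le ⟨P, hP, rfl⟩

/-- `2ε` is attained. -/
theorem exists_eq_epsL {N : Set (Fin 2 →₀ ℕ)} (hN : N.Nonempty) : ∃ P ∈ N, P 1 = epsL N := by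
  obtain ⟨P, hP, hPeq⟩ := Nat.sInf_mem (hN.image (fun P : Fin 2 →₀ ℕ => P 1))
  exact ⟨P, hP, hPeq⟩

/-- `2β ≤ P₁` on the leftmost column. -/
theorem betaL_le {N : Set (Fin 2 →₀ ℕ)} {P : Fin 2 →₀ ℕ} (hP : P ∈ N) (h0 : P 0 = alphaL N) : betaL N ≤ P 1 :=
  Nat.sInf_le ⟨P, ⟨hP, h0⟩, rfl⟩

/-- `(2α, 2β)` is attained: the lex-min point. -/
theorem exists_eq_betaL {N : Set (Fin 2 →₀ ℕ)} (hN : N.Nonempty) : ∃ P ∈ N, P 0 = alphaL N ∧ P 1 = betaL N := by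
  obtain ⟨Q, hQ, hQ0⟩ := exists_eq_alphaL hN
  have hne : ({P | P ∈ N ∧ P 0 = alphaL N} : Set (Fin 2 →₀ ℕ)).Nonempty := ⟨Q, hQ, hQ0⟩
  obtain ⟨P, ⟨hP, hP0⟩, hPeq⟩ := Nat.sInf_mem (hne.image (fun P : Fin 2 →₀ ℕ => P 1))
  exact ⟨P, hP, hP0, hPeq⟩

/-- `2γ⁻ ≤ P₁` on the `δ`-face. -/
theorem gammaL_le {N : Set (Fin 2 →₀ ℕ)} {P : Fin 2 →₀ ℕ} (hP : P ∈ N) (hd : P 0 + P 1 = deltaL N) : gammaL N ≤ P 1 :=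
  Nat.sInf_le ⟨P, ⟨hP, hd⟩, rfl⟩

/-- `2γ⁻` is attained on the `δ`-face. -/
theorem exists_eq_gammaL {N : Set (Fin 2 →₀ ℕ)} (hN : N.Nonempty) :
    ∃ P ∈ N, P 0 + P 1 = deltaL N ∧ P 1 = gammaL N := by
  obtain ⟨Q, hQ, hQd⟩ := exists_eq_deltaL hN
  have hne : ({P | P ∈ N ∧ P 0 + P 1 = deltaL N} : Set (Fin 2 →₀ ℕ)).Nonempty := ⟨Q, hQ, hQd⟩
  obtain ⟨P, ⟨hP, hPd⟩, hPeq⟩ := Nat.sInf_mem (hne.image (fun P : Fin 2 →₀ ℕ => P 1))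
  exact ⟨P, hP, hPd, hPeq⟩

/-- `2ζ ≤ P₀` on the lowest row. -/
theorem zetaL_le {N : Set (Fin 2 →₀ ℕ)} {P : Fin 2 →₀ ℕ} (hP : P ∈ N) (h1 : P 1 = epsL N) : zetaL N ≤ P 0 :=
  Nat.sInf_le ⟨P, ⟨hP, h1⟩, rfl⟩

/-- `(2ζ, 2ε)` is attained. -/
theorem exists_eq_zetaL {N : Set (Fin 2 →₀ ℕ)} (hN : N.Nonempty) : ∃ P ∈ N, P 1 = epsL N ∧ P 0 = zetaL N := by
  obtain ⟨Q, hQ, hQ1⟩ := exists_eq_epsL hN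
  have hne : ({P | P ∈ N ∧ P 1 = epsL N} : Set (Fin 2 →₀ ℕ)).Nonempty := ⟨Q, hQ, hQ1⟩
  obtain ⟨P, ⟨hP, hP1⟩, hPeq⟩ := Nat.sInf_mem (hne.image (fun P : Fin 2 →₀ ℕ => P 0))
  exact ⟨P, hP, hP1, hPeq⟩

/-- `2δ ≤ 2α + 2β` (CJS (11.1)). -/
theorem deltaL_le_alphaL_add_betaL {N : Set (Fin 2 →₀ ℕ)} (hN : N.Nonempty) : deltaL N ≤ alphaL N + betaL N := by
  obtain ⟨P, hP, hP0, hP1⟩ := exists_eq_betaL hN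
  rw [← hP0, ← hP1]
  exact deltaL_le hP

/-- `2γ⁻ ≤ 2β` (CJS (11.1): `γ⁻ ≤ γ⁺ ≤ β`): every point `Q` of the `δ`-face has `Q₁ = δ − Q₀ ≤ δ − α ≤ β`. -/
theorem gammaL_le_betaL {N : Set (Fin 2 →₀ ℕ)} (hN : N.Nonempty) : gammaL N ≤ betaL N := by
  obtain ⟨Q, hQ, hQd⟩ := exists_eq_deltaL hN
  have hα := alphaL_le hQ
  have hδ := deltaL_le_alphaL_add_betaL hN
  have hγ := gammaL_le hQ hQd
  omega

/-! ## The `u₁`-chart point blow-up: `N′ = Ψ(N)`, `Ψ(P) = (P₀ + P₁ − 2, P₁)` -/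

section psi

variable {N} (hN2 : ∀ P ∈ N, 2 ≤ P 0 + P 1)
include hN2

omit hN2 in
/-- `2α′ = 2δ − 2`. -/
theorem alphaL_image_psi (hN : N.Nonempty) : alphaL (psi 2 '' N) = deltaL N - 2 := by
  apply le_antisymm
  · obtain ⟨P, hP, hPd⟩ := exists_eq_deltaL hN
    have h := alphaL_le (N := psi 2 '' N) ⟨P, hP, rfl⟩
    rw [psi_apply_zero] at h
    omega
  · obtain ⟨Q, ⟨P, hP, rfl⟩, hQ0⟩ := exists_eq_alphaL (hN.image (psi 2))
    rw [← hQ0, psi_apply_zero]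
    have := deltaL_le hP
    omega

/-- The leftmost column of `Ψ(N)` is the image of the `δ`-face of `N`. -/
theorem mem_image_psi_col_iff (hN : N.Nonempty) (Q : Fin 2 →₀ ℕ) :
    (Q ∈ psi 2 '' N ∧ Q 0 = alphaL (psi 2 '' N)) ↔ ∃ P ∈ N, P 0 + P 1 = deltaL N ∧ Q = psi 2 P := by
  rw [alphaL_image_psi hN]
  have hδ2 : 2 ≤ deltaL N := by
    obtain ⟨R, hR, hRd⟩ := exists_eq_deltaL hN
    have := hN2 R hR
    omega
  constructor
  · rintro ⟨⟨P, hP, rfl⟩, h0⟩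
    rw [psi_apply_zero] at h0
    have := deltaL_le hP
    have := hN2 P hP
    refine ⟨P, hP, by omega, rfl⟩
  · rintro ⟨P, hP, hPd, rfl⟩
    refine ⟨⟨P, hP, rfl⟩, ?_⟩
    rw [psi_apply_zero]
    omega

/-- `2β′ = 2γ⁻` (CJS 12.1 (3)). -/
theorem betaL_image_psi (hN : N.Nonempty) : betaL (psi 2 '' N) = gammaL N := by
  unfold betaL gammaL
  congr 1
  ext n
  constructor
  · rintro ⟨Q, hQ, rfl⟩
    obtain ⟨P, hP, hPd, rfl⟩ := (mem_image_psi_col_iff hN2 hN Q).mp hQ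
    exact ⟨P, ⟨hP, hPd⟩, (psi_apply_one 2 P).symm⟩
  · rintro ⟨P, ⟨hP, hPd⟩, rfl⟩
    exact ⟨psi 2 P, (mem_image_psi_col_iff hN2 hN _).mpr ⟨P, hP, hPd, rfl⟩, psi_apply_one 2 P⟩

/-- `β′ ≤ β` under the `u₁`-chart point blow-up (CJS Prop. 13.5, case `(1:0)`). -/
theorem betaL_image_psi_le (hN : N.Nonempty) : betaL (psi 2 '' N) ≤ betaL N := by
  rw [betaL_image_psi hN2 hN]
  exact gammaL_le_betaL hN

omit hN2 in
/-- `2ε′ = 2ε`. -/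
theorem epsL_image_psi : epsL (psi 2 '' N) = epsL N := by
  unfold epsL
  congr 1
  ext n
  constructor
  · rintro ⟨Q, ⟨P, hP, rfl⟩, rfl⟩
    exact ⟨P, hP, (psi_apply_one 2 P).symm⟩
  · rintro ⟨P, hP, rfl⟩
    exact ⟨psi 2 P, ⟨P, hP, rfl⟩, psi_apply_one 2 P⟩

/-- `2ζ′ = 2ζ + 2ε − 2` (CJS, proof of Thm 13.7: `ζ` drops by `1 − ε` per point blow-up). -/
theorem zetaL_image_psi (hN : N.Nonempty) : zetaL (psi 2 '' N) = zetaL N + epsL N - 2 := by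
  have hrow : ∀ Q, (Q ∈ psi 2 '' N ∧ Q 1 = epsL (psi 2 '' N)) ↔ ∃ P ∈ N, P 1 = epsL N ∧ Q = psi 2 P := by
    intro Q
    rw [epsL_image_psi]
    constructor
    · rintro ⟨⟨P, hP, rfl⟩, h1⟩
      rw [psi_apply_one] at h1
      exact ⟨P, hP, h1, rfl⟩
    · rintro ⟨P, hP, hP1, rfl⟩
      exact ⟨⟨P, hP, rfl⟩, by rw [psi_apply_one]; exact hP1⟩
  apply le_antisymm
  · obtain ⟨P, hP, hP1, hP0⟩ := exists_eq_zetaL hN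
    have h := zetaL_le (N := psi 2 '' N) (P := psi 2 P) ⟨P, hP, rfl⟩ (by rw [psi_apply_one, epsL_image_psi]; exact hP1)
    rw [psi_apply_zero] at h
    omega
  · obtain ⟨Q, hQ, hQ1, hQ0⟩ := exists_eq_zetaL (hN.image (psi 2))
    obtain ⟨P, hP, hP1, rfl⟩ := (hrow Q).mp ⟨hQ, hQ1⟩
    rw [← hQ0, psi_apply_zero]
    have := zetaL_le hP hP1
    have := hN2 P hP
    omega

end psi

/-! ## The `u₂`-chart point blow-up: `N′ = Φ(N)`, `Φ(P) = (P₀, P₀ + P₁ − 2)` -/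

/-- The exponent map of the `u₂`-chart: `Φ(P) = (P₀, P₀ + P₁ − 2)`. -/
def phi (P : Fin 2 →₀ ℕ) : Fin 2 →₀ ℕ := Finsupp.single 0 (P 0) + Finsupp.single 1 (P 0 + P 1 - 2)

/-- Components of `phi`. -/
@[simp] theorem phi_apply_zero (P : Fin 2 →₀ ℕ) : phi P 0 = P 0 := by simp [phi]

/-- Components of `phi`. -/
@[simp] theorem phi_apply_one (P : Fin 2 →₀ ℕ) : phi P 1 = P 0 + P 1 - 2 := by simp [phi]

/-- `2α′ = 2α` under the `u₂`-chart. -/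
theorem alphaL_image_phi : alphaL (phi '' N) = alphaL N := by
  unfold alphaL
  congr 1
  ext n
  constructor
  · rintro ⟨Q, ⟨P, hP, rfl⟩, rfl⟩
    exact ⟨P, hP, (phi_apply_zero P).symm⟩
  · rintro ⟨P, hP, rfl⟩
    exact ⟨phi P, ⟨P, hP, rfl⟩, phi_apply_zero P⟩

/-- `2β′ = 2α + 2β − 2` under the `u₂`-chart (CJS 12.2 / 13.4 (2)); hence `β′ < β` when `2α ≤ 1`. -/
theorem betaL_image_phi {N : Set (Fin 2 →₀ ℕ)} (hN2 : ∀ P ∈ N, 2 ≤ P 0 + P 1) (hN : N.Nonempty) :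
    betaL (phi '' N) = alphaL N + betaL N - 2 := by
  have hcol : ∀ Q, (Q ∈ phi '' N ∧ Q 0 = alphaL (phi '' N)) ↔ ∃ P ∈ N, P 0 = alphaL N ∧ Q = phi P := by
    intro Q
    rw [alphaL_image_phi]
    constructor
    · rintro ⟨⟨P, hP, rfl⟩, h0⟩
      rw [phi_apply_zero] at h0
      exact ⟨P, hP, h0, rfl⟩
    · rintro ⟨P, hP, hP0, rfl⟩
      exact ⟨⟨P, hP, rfl⟩, by rw [phi_apply_zero]; exact hP0⟩
  apply le_antisymm
  · obtain ⟨P, hP, hP0, hP1⟩ := exists_eq_betaL hN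
    have h := betaL_le (N := phi '' N) (P := phi P) ⟨P, hP, rfl⟩ (by rw [phi_apply_zero, alphaL_image_phi]; exact hP0)
    rw [phi_apply_one] at h
    omega
  · obtain ⟨Q, hQ, hQ0, hQ1⟩ := exists_eq_betaL (hN.image phi)
    obtain ⟨P, hP, hP0, rfl⟩ := (hcol Q).mp ⟨hQ, hQ0⟩
    rw [← hQ1, phi_apply_one]
    have := betaL_le hP hP0
    have := hN2 P hP
    omega

/-! ## The curve blow-ups: shifts by `(2,0)` and `(0,2)` -/

/-- The shift `P ↦ P − (2, 0)` (blow-up of `V(y, u₁)`). -/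
def shiftOne (P : Fin 2 →₀ ℕ) : Fin 2 →₀ ℕ := Finsupp.single 0 (P 0 - 2) + Finsupp.single 1 (P 1)

/-- The shift `P ↦ P − (0, 2)` (blow-up of `V(y, u₂)`). -/
def shiftTwo (P : Fin 2 →₀ ℕ) : Fin 2 →₀ ℕ := Finsupp.single 0 (P 0) + Finsupp.single 1 (P 1 - 2)

/-- Components of the shifts. -/
@[simp] theorem shiftOne_apply_zero (P : Fin 2 →₀ ℕ) : shiftOne P 0 = P 0 - 2 := by simp [shiftOne]
/-- Components of the shifts. -/
@[simp] theorem shiftOne_apply_one (P : Fin 2 →₀ ℕ) : shiftOne P 1 = P 1 := by simp [shiftOne]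
/-- Components of the shifts. -/
@[simp] theorem shiftTwo_apply_zero (P : Fin 2 →₀ ℕ) : shiftTwo P 0 = P 0 := by simp [shiftTwo]
/-- Components of the shifts. -/
@[simp] theorem shiftTwo_apply_one (P : Fin 2 →₀ ℕ) : shiftTwo P 1 = P 1 - 2 := by simp [shiftTwo]

/-- `2α′ = 2α − 2` under the blow-up of `V(y,u₁)` (truncated subtraction; exact when all points have `P₀ ≥ 2`). -/
theorem alphaL_image_shiftOne {N : Set (Fin 2 →₀ ℕ)} (hN : N.Nonempty) :
    alphaL (shiftOne '' N) = alphaL N - 2 := by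
  apply le_antisymm
  · obtain ⟨P, hP, hP0⟩ := exists_eq_alphaL hN
    have h := alphaL_le (N := shiftOne '' N) ⟨P, hP, rfl⟩
    rw [shiftOne_apply_zero] at h
    omega
  · obtain ⟨Q, ⟨P, hP, rfl⟩, hQ0⟩ := exists_eq_alphaL (hN.image shiftOne)
    rw [← hQ0, shiftOne_apply_zero]
    have := alphaL_le hP
    omega

/-- `2β′ = 2β` under the blow-up of `V(y,u₁)`. -/
theorem betaL_image_shiftOne {N : Set (Fin 2 →₀ ℕ)} (hN1 : ∀ P ∈ N, 2 ≤ P 0) (hN : N.Nonempty) :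
    betaL (shiftOne '' N) = betaL N := by
  have hα2 : 2 ≤ alphaL N := by
    obtain ⟨R, hR, hR0⟩ := exists_eq_alphaL hN
    have := hN1 R hR
    omega
  unfold betaL
  rw [alphaL_image_shiftOne hN]
  congr 1
  ext n
  constructor
  · rintro ⟨Q, ⟨⟨P, hP, rfl⟩, h0⟩, rfl⟩
    rw [shiftOne_apply_zero] at h0
    have := hN1 P hP
    have := alphaL_le hP
    exact ⟨P, ⟨hP, by omega⟩, (shiftOne_apply_one P).symm⟩
  · rintro ⟨P, ⟨hP, hP0⟩, rfl⟩
    refine ⟨shiftOne P, ⟨⟨P, hP, rfl⟩, ?_⟩, shiftOne_apply_one P⟩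
    rw [shiftOne_apply_zero, hP0]

/-- `2ε′ = 2ε` under the blow-up of `V(y,u₁)`. -/
theorem epsL_image_shiftOne (N : Set (Fin 2 →₀ ℕ)) : epsL (shiftOne '' N) = epsL N := by
  unfold epsL
  congr 1
  ext n
  constructor
  · rintro ⟨Q, ⟨P, hP, rfl⟩, rfl⟩
    exact ⟨P, hP, (shiftOne_apply_one P).symm⟩
  · rintro ⟨P, hP, rfl⟩
    exact ⟨shiftOne P, ⟨P, hP, rfl⟩, shiftOne_apply_one P⟩

/-- `2ζ′ = 2ζ − 2` under the blow-up of `V(y,u₁)`. -/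
theorem zetaL_image_shiftOne {N : Set (Fin 2 →₀ ℕ)} (hN : N.Nonempty) :
    zetaL (shiftOne '' N) = zetaL N - 2 := by
  have hrow : ∀ Q, (Q ∈ shiftOne '' N ∧ Q 1 = epsL (shiftOne '' N)) ↔ ∃ P ∈ N, P 1 = epsL N ∧ Q = shiftOne P := by
    intro Q
    rw [epsL_image_shiftOne]
    constructor
    · rintro ⟨⟨P, hP, rfl⟩, h1⟩
      rw [shiftOne_apply_one] at h1
      exact ⟨P, hP, h1, rfl⟩
    · rintro ⟨P, hP, hP1, rfl⟩
      exact ⟨⟨P, hP, rfl⟩, by rw [shiftOne_apply_one]; exact hP1⟩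
  apply le_antisymm
  · obtain ⟨P, hP, hP1, hP0⟩ := exists_eq_zetaL hN
    have h := zetaL_le (N := shiftOne '' N) (P := shiftOne P) ⟨P, hP, rfl⟩ (by rw [shiftOne_apply_one, epsL_image_shiftOne]; exact hP1)
    rw [shiftOne_apply_zero] at h
    omega
  · obtain ⟨Q, hQ, hQ1, hQ0⟩ := exists_eq_zetaL (hN.image shiftOne)
    obtain ⟨P, hP, hP1, rfl⟩ := (hrow Q).mp ⟨hQ, hQ1⟩
    rw [← hQ0, shiftOne_apply_zero]
    have := zetaL_le hP hP1
    omega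

/-- `2β′ = 2β − 2` under the blow-up of `V(y,u₂)` (all points with `P₁ ≥ 2`). -/
theorem betaL_image_shiftTwo {N : Set (Fin 2 →₀ ℕ)} (hN1 : ∀ P ∈ N, 2 ≤ P 1) (hN : N.Nonempty) :
    betaL (shiftTwo '' N) = betaL N - 2 := by
  have hα : alphaL (shiftTwo '' N) = alphaL N := by
    unfold alphaL
    congr 1
    ext n
    constructor
    · rintro ⟨Q, ⟨P, hP, rfl⟩, rfl⟩
      exact ⟨P, hP, (shiftTwo_apply_zero P).symm⟩
    · rintro ⟨P, hP, rfl⟩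
      exact ⟨shiftTwo P, ⟨P, hP, rfl⟩, shiftTwo_apply_zero P⟩
  have hcol : ∀ Q, (Q ∈ shiftTwo '' N ∧ Q 0 = alphaL (shiftTwo '' N)) ↔ ∃ P ∈ N, P 0 = alphaL N ∧ Q = shiftTwo P := by
    intro Q
    rw [hα]
    constructor
    · rintro ⟨⟨P, hP, rfl⟩, h0⟩
      rw [shiftTwo_apply_zero] at h0
      exact ⟨P, hP, h0, rfl⟩
    · rintro ⟨P, hP, hP0, rfl⟩
      exact ⟨⟨P, hP, rfl⟩, by rw [shiftTwo_apply_zero]; exact hP0⟩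
  apply le_antisymm
  · obtain ⟨P, hP, hP0, hP1⟩ := exists_eq_betaL hN
    have h := betaL_le (N := shiftTwo '' N) (P := shiftTwo P) ⟨P, hP, rfl⟩ (by rw [shiftTwo_apply_zero, hα]; exact hP0)
    rw [shiftTwo_apply_one] at h
    omega
  · obtain ⟨Q, hQ, hQ0, hQ1⟩ := exists_eq_betaL (hN.image shiftTwo)
    obtain ⟨P, hP, hP0, rfl⟩ := (hcol Q).mp ⟨hQ, hQ0⟩
    rw [← hQ1, shiftTwo_apply_one]
    have := betaL_le hP hP0
    have := hN1 P hP
    omega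

end MonicDescent

end Summit.ResolutionOfSingularities.ResolutionOfSingularities.Theorems

end
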